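import Summits.BirchSwinnertonDyer.BirchSwinnertonDyer.Theorems.ByReductionTypeAtTwoOrdKatoHalfAtTwoIsoConjATwoOfPointFieldMu
import Literature.NumberTheory.IwasawaTheory.ClassNumberPExpZeroCyclotomicFour
import Literature.NumberTheory.EllipticCurves.DivisionFieldReducibleBorelKernel
import Literature.NumberTheory.EllipticCurves.AnomalousOfRationalTorsionProofs
import HarnessLib

/-!
# Route `ByReductionTypeAtTwo` (K4), the `E[2]`-REDUCIBLE additive branch (child C2″ `AdditivePotGoodReducibleRestAtTwo`,
# item stmt-BirchSwinnertonDyer-22616; the `t ≥ 1` classes of C3″ 22617): COATES–SUJATHA'S CONJECTURE A AT `p = 2` IS A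
# KERNEL THEOREM FOR EVERY ELLIPTIC CURVE OVER `ℚ` WITH REDUCIBLE `E[2]`
# (a `--supports 22616` file; seat `bsd-2adic-k4-w2` GEN 9; companion of `…AdditiveReducibleKatoMemberSharpOfConjARed.lean`)

HONEST FRAMING (cell `bsd-2adic`, D-0036/D-0054): THEOREMS ONLY (no definition, no named fact, no `sorry`); everything here is
PROVED OUTRIGHT (no hypothesis beyond the curve; axioms `propext`, `Classical.choice`, `Quot.sound`). It is statement (A) at ONE
prime for ONE family of curves — it closes no route item by itself (C2″/C3″/C1″ stay open at the `∀`-level; the sequel file feeds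
it into the C2″ road, which stays conditional on four PRINT facts and one READING); BSD is not proved by any of this.

WHAT IS PROVED OUTRIGHT (§3). For EVERY elliptic curve `W/ℚ` whose mod-`2` representation is REDUCIBLE (equivalently: `W` has a
rational point of order `2`; no minimality, reduction-type, rank or CM hypothesis):

  `conjA_two_of_not_hasIrreducibleModPGaloisRep_two W hred : ∀ κ cyclotomic, ∃ γ D, D.X` finitely generated over `ℤ₂`

— Coates–Sujatha's statement (A) at `(W, 2)` in the route's `∃ γ D` currency (a fine Selmer dual datum of `W` over `ℚ_∞` that
is a finitely generated `ℤ₂`-module). ROAD (all tree theorems): reducible `W[2]` has a NON-ZERO `Γ_ℚ`-FIXED point `P` (§1: a stable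
subgroup `C ≠ ⊥, ⊤` of `W[2] ≅ (ℤ/2)²` has order `2`, so `C = {0, P}` and every `σ` fixes `P`); the carrier of cruxlead-19573-w2's
KERNEL door `PointFieldMu.exists_fineSelmerDualData_moduleFinite_of_classicalMu_pointField_adjoin` (p718233: (A)₂ downstairs ⟸
Iwasawa's `μ₂ = 0` for every cyclotomic `ℤ₂`-extension of `ℚ̄^{Stab P} ⊔ ℚ⟮i⟯`, by unipotent dévissage over that totally complex
field — NO Lim 2017 fact, NO ascent) is then `ℚ̄^{⊤} ⊔ ℚ⟮i⟯ = ℚ⟮i⟯`, a FOURTH CYCLOTOMIC FIELD (§2), and EVERY `ℤ₂`-extension of a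
fourth cyclotomic field has `μ = 0` — indeed `e_n = 0` for all `n` — by the tree's `classicalMuVanishes_of_isCyclotomicExtension_four`
(Iwasawa 1956 / Greenberg 2001 Prop. 2.1 at `h(ℚ(√−1)) = 1` with ONE prime above `2`; Weber). In print the analogous statement is
Coates–Sujatha 2005 Cor. 3.6 / Wuthrich 2014 Lemma 14 / Lim 2017 Remark (a) — for ODD `p` («`F(E[p^∞])/F` pro-`p` and
`μ(F(μ_p)^{cyc}) = 0` ⟹ Conjecture A»); the `p = 2` case over `ℚ` is not in print and is settled here in the kernel.

CONSEQUENCE (sequel file `…AdditiveReducibleKatoMemberSharpKernelA.lean`). addL2x's `conjA_two_of_not_irreducible hLim2 hFW`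
(p621123 road: Lim 2017 Thm. 3.5 at `2` in the DOWNSTAIRS `L`-form + Ferrero–Washington) was the ONLY consumer of `hLim2`/`hFW` on the
reducible branch (Kato's member `W'` has reducible `W'[2]`). Feeding §3 into the companion's re-keyed road
(`…AdditiveReducibleKatoMemberSharpOfConjARed.lean`, hypothesis `hA` := §3) gives C2″ VERBATIM from `hmod`, `hrat`, `hin`, `hCassels`,
`hGZK` (GEN 4's road had SEVEN binders incl. `hLim2`, `hFW`): on the `E[2]`-REDUCIBLE additive branch the print heads «Lim 2017
Thm 3.5 at 2» and «Ferrero–Washington» of C5‴ `AdditivePrintedInputsAtTwo` become IDLE.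

* §1 `exists_twoTorsion_ne_zero_forall_smul_eq_of_not_irreducible` (any field of characteristic `0`).
* §2 `fixedField_top_absoluteGaloisGroup_eq_bot`, `isPrimitiveRoot_four_of_sq_eq_neg_one`,
  `classicalMuVanishes_pointField_adjoin_I_of_forall_smul_eq`.
* §3 **`conjA_two_of_not_hasIrreducibleModPGaloisRep_two`**, `conjA_two_of_dvd_torsionOrder_two` (`2 ∣ #W(ℚ)_tors`).

References: [CoatesSujatha2005] Conj. A, Thm. 3.4, Cor. 3.6; [Wuthrich2014] Lemma 14; [Lim2017FineSelmer] §3 Lemma 3.2, Thm. 3.5,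
Remark (a); [Greenberg2001IwasawaPastPresent] Prop. 2.1; [Washington1997] Thm. 10.4, Prop. 13.22, Cor. 10.5 (Weber);
[Iwasawa1973MuInvariants] §1; [SilvermanAEC2009] III.6.4, VIII.§1; [Kato2004Asterisque] Prop. 14.16 (2); [Cassels1965ArithmeticVIII];
tree p718233 (w2 GEN 6), p716773, p717389.
-/

set_option autoImplicit false
-- sibling precedent (`…AdditiveReducibleKatoMemberSharpNST.lean`): the directory name repeats the summit name
set_option linter.dupNamespace false

noncomputable section

open scoped Classical

namespace Summit.BirchSwinnertonDyer.BirchSwinnertonDyer.Theorems.AddKatoTwo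

open WeierstrassCurve Field Literature.NumberTheory.EllipticCurves
  Literature.NumberTheory.EllipticCurves.Rank1Residual
  Literature.NumberTheory.EllipticCurves.Rank1Residual.Typed
  Literature.NumberTheory.IwasawaTheory
  Summit.BirchSwinnertonDyer.BirchSwinnertonDyer.Theorems.SteinbergFibreAtTwo

/-! ## §1 A reducible `E[2]` has a non-zero `Γ`-fixed `2`-torsion point -/

section Fixed

variable {K : Type} [Field K] [CharZero K] (W : WeierstrassCurve K) [W.IsElliptic]

/-- **Reducible `E[2]` ⟹ a NON-ZERO `2`-torsion point fixed by all of `Γ_K`** (any field `K` of characteristic `0`, `E/K`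
elliptic): a `Γ_K`-stable subgroup `C ≠ ⊥, ⊤` of `E[2]` (`#E[2] = 4`, `natCard_geomTorsion_eq_sq_of_charZero`) has order `2`
(`card_eq_of_ne_bot_of_ne_top`), so `C = {0, P}`; `σ • P ∈ C` is non-zero, hence equals `P`. (At `p = 2` a stable LINE is a
fixed POINT: `GL₁(𝔽₂) = 1`.) [cite: SilvermanAEC2009, Cor. III.6.4 (b) (E[m] ≅ (ℤ/m)²) and VIII.§1] [cite: Serre1972, §4 (irreducibility)] -/
theorem exists_twoTorsion_ne_zero_forall_smul_eq_of_not_irreducible (h : ¬ W.HasIrreducibleModPGaloisRep 2) :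
    ∃ P : geomTorsion W 2, P ≠ 0 ∧ ∀ σ : absoluteGaloisGroup K, σ • P = P := by
  haveI : Fact (Nat.Prime 2) := ⟨Nat.prime_two⟩
  -- a stable subgroup `C ≠ ⊥, ⊤` of `E[2]`
  have h' : ∃ C : AddSubgroup (geomTorsion W ((2 : ℕ) : ℤ)),
      (∀ (σ : absoluteGaloisGroup K) (x : geomTorsion W ((2 : ℕ) : ℤ)), x ∈ C → σ • x ∈ C) ∧ C ≠ ⊥ ∧ C ≠ ⊤ := by
    unfold HasIrreducibleModPGaloisRep at h
    push Not at h
    obtain ⟨C, hC, h1, h2⟩ := h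
    exact ⟨C, fun σ x hx => hC σ x hx, h1, h2⟩
  obtain ⟨C, hC, h1, h2⟩ := h'
  have hV := natCard_geomTorsion_eq_sq_of_charZero (W := W) Nat.prime_two
  have hcard : Nat.card C = 2 := card_eq_of_ne_bot_of_ne_top (W := W) hV h1 h2
  -- `C = {0, P}`
  obtain ⟨P, hPC, hP0⟩ : ∃ P : geomTorsion W ((2 : ℕ) : ℤ), P ∈ C ∧ P ≠ 0 := by
    by_contra hcon
    push Not at hcon
    exact h1 ((AddSubgroup.eq_bot_iff_forall C).2 hcon)
  obtain ⟨y, -, hy⟩ := (Nat.card_eq_two_iff' (⟨0, C.zero_mem⟩ : C)).1 hcard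
  refine ⟨P, hP0, fun σ => ?_⟩
  have hσP : σ • P ∈ C := hC σ P hPC
  have hσP0 : σ • P ≠ 0 := fun h0 => hP0 ((smul_eq_zero_iff_eq σ).1 h0)
  have e1 : (⟨σ • P, hσP⟩ : C) = y := hy _ (fun h0 => hσP0 (congrArg Subtype.val h0))
  have e2 : (⟨P, hPC⟩ : C) = y := hy _ (fun h0 => hP0 (congrArg Subtype.val h0))
  exact congrArg Subtype.val (e1.trans e2.symm)

end Fixed

/-! ## §2 The carrier `ℚ̄^{Stab P} ⊔ ℚ⟮i⟯` of a `Γ`-fixed `2`-torsion point is a fourth cyclotomic field: `μ₂ = 0` -/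

/-- `F̄^{Γ_F} = F` (characteristic `0`, so `F̄/F` is Galois): the fixed field of the whole absolute Galois group is the bottom
intermediate field (Mathlib's `InfiniteGalois.fixedField_bot`, stated for a general `F` so that at `F = ℚ` the `ℚ`-algebra
structure on `ℚ̄` is the one of `AlgebraicClosure`). [cite: MilneFT2022, Ch. 7 (Krull's infinite Galois correspondence)] -/
theorem fixedField_top_absoluteGaloisGroup_eq_bot (F : Type) [Field F] [CharZero F] :
    IntermediateField.fixedField (⊤ : Subgroup (absoluteGaloisGroup F)) = (⊥ : IntermediateField F (AlgebraicClosure F)) :=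
  InfiniteGalois.fixedField_bot


/-- A square root of `−1` is a primitive `4`-th root of unity (characteristic `0`). [folklore] -/
theorem isPrimitiveRoot_four_of_sq_eq_neg_one {F : Type} [Field F] [CharZero F] {i : F} (hi : i ^ 2 = -1) :
    IsPrimitiveRoot i 4 := by
  refine IsPrimitiveRoot.mk_of_lt i (by norm_num) (by rw [show (4 : ℕ) = 2 * 2 by rfl, pow_mul, hi]; norm_num) ?_
  intro k hk hk4
  interval_cases k
  · rw [pow_one]; intro h1; rw [h1] at hi; norm_num at hi
  · rw [hi]; norm_num
  · rw [show (3 : ℕ) = 2 + 1 by rfl, pow_succ, hi]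
    intro h; have : i = -1 := by linear_combination -h
    rw [this] at hi; norm_num at hi

/-- **`μ₂ = 0` for EVERY `ℤ₂`-extension of w2's carrier `ℚ̄^{Stab P} ⊔ ℚ⟮i⟯` when `P` is `Γ_ℚ`-fixed** (`i² = −1`): `Stab P = ⊤`,
`ℚ̄^{⊤} = ⊥` (`InfiniteGalois.fixedField_bot`, `ℚ̄/ℚ` Galois), so the carrier is `ℚ⟮i⟯`, a `{4}`-cyclotomic extension of `ℚ`
(`IsPrimitiveRoot.intermediateField_adjoin_isCyclotomicExtension`, transported along the equality);
then `classicalMuVanishes_of_isCyclotomicExtension_four` (Iwasawa 1956 at the fourth cyclotomic field: `h = 1`, one prime above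
`2`; growth form `e_n = 0`, any `ℤ₂`-extension, not only the cyclotomic one). Fact-free.
[cite: Greenberg2001IwasawaPastPresent, Prop. 2.1 p. 339 and p. 342] [cite: Washington1997, Prop. 13.22 and Cor. 10.5] -/
theorem classicalMuVanishes_pointField_adjoin_I_of_forall_smul_eq (W : WeierstrassCurve ℚ) [W.IsElliptic]
    {P : geomTorsion W 2} (hfix : ∀ σ : absoluteGaloisGroup ℚ, σ • P = P)
    {i : AlgebraicClosure ℚ} (hi : i ^ 2 = -1)
    (κF : ZpExtension ↥(IntermediateField.fixedField (MulAction.stabilizer (absoluteGaloisGroup ℚ) P) ⊔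
        IntermediateField.adjoin ℚ ({i} : Set (AlgebraicClosure ℚ))) 2) :
    ClassicalMuVanishes κF := by
  haveI : Fact (Nat.Prime 2) := ⟨Nat.prime_two⟩
  -- (the `ℚ`-algebra instances on `ℚ̄` found by unification are `DivisionRing.toRatAlgebra`; supply the algebraicity by term)
  haveI : Algebra.IsAlgebraic ℚ (AlgebraicClosure ℚ) := AlgebraicClosure.isAlgebraic ℚ
  haveI : Algebra.IsIntegral ℚ (AlgebraicClosure ℚ) := Algebra.isAlgebraic_iff_isIntegral.mp (AlgebraicClosure.isAlgebraic ℚ)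
  have hint : IsIntegral ℚ i := by
    refine ⟨Polynomial.X ^ 2 + 1, Polynomial.monic_X_pow_add_C _ two_ne_zero, ?_⟩
    simp [hi]
  have hstab : MulAction.stabilizer (absoluteGaloisGroup ℚ) P = ⊤ := by
    rw [eq_top_iff]
    intro σ _
    exact hfix σ
  have hbot : IntermediateField.fixedField (MulAction.stabilizer (absoluteGaloisGroup ℚ) P) = ⊥ := by
    rw [hstab]
    exact fixedField_top_absoluteGaloisGroup_eq_bot ℚ
  have hF : IntermediateField.fixedField (MulAction.stabilizer (absoluteGaloisGroup ℚ) P) ⊔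
      IntermediateField.adjoin ℚ ({i} : Set (AlgebraicClosure ℚ)) = IntermediateField.adjoin ℚ ({i} : Set (AlgebraicClosure ℚ)) := by
    rw [hbot]; exact bot_sup_eq _
  have h4 : IsPrimitiveRoot i 4 := isPrimitiveRoot_four_of_sq_eq_neg_one hi
  haveI : NeZero (4 : ℕ) := ⟨by norm_num⟩
  haveI : FiniteDimensional ℚ ↥(IntermediateField.adjoin ℚ ({i} : Set (AlgebraicClosure ℚ))) :=
    IntermediateField.adjoin.finiteDimensional hint
  haveI hcyc : IsCyclotomicExtension {4} ℚ ↥(IntermediateField.adjoin ℚ ({i} : Set (AlgebraicClosure ℚ))) :=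
    h4.intermediateField_adjoin_isCyclotomicExtension ℚ
  haveI : IsCyclotomicExtension {2 ^ 2} ℚ ↥(IntermediateField.fixedField (MulAction.stabilizer (absoluteGaloisGroup ℚ) P) ⊔
      IntermediateField.adjoin ℚ ({i} : Set (AlgebraicClosure ℚ))) := by
    rw [show ({2 ^ 2} : Set ℕ) = {4} by norm_num, hF]
    exact hcyc
  haveI : FiniteDimensional ℚ ↥(IntermediateField.fixedField (MulAction.stabilizer (absoluteGaloisGroup ℚ) P) ⊔
      IntermediateField.adjoin ℚ ({i} : Set (AlgebraicClosure ℚ))) := by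
    rw [hF]; infer_instance
  haveI : NumberField ↥(IntermediateField.fixedField (MulAction.stabilizer (absoluteGaloisGroup ℚ) P) ⊔
      IntermediateField.adjoin ℚ ({i} : Set (AlgebraicClosure ℚ))) := NumberField.mk
  exact classicalMuVanishes_of_isCyclotomicExtension_four _ κF

/-! ## §3 (A)₂ for every elliptic curve over `ℚ` with reducible `E[2]` — PROVED OUTRIGHT -/

/-- **COATES–SUJATHA'S CONJECTURE A AT `p = 2` FOR EVERY ELLIPTIC CURVE OVER `ℚ` WITH REDUCIBLE `E[2]` — KERNEL, no named fact.**
For `W/ℚ` elliptic with `¬ W.HasIrreducibleModPGaloisRep 2` and every cyclotomic `ℤ₂`-extension `κ` of `ℚ`, some fine Selmer dual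
datum `D` of `W` over `ℚ_∞` has `D.X` finitely generated over `ℤ₂` (the route's `∃ γ D` spelling of statement (A) at `(W, 2)`).
§1 gives a non-zero `Γ_ℚ`-fixed `P ∈ W[2]`; w2's KERNEL door `PointFieldMu.exists_fineSelmerDualData_moduleFinite_of_classicalMu_pointField_adjoin`
(unipotent dévissage over the totally complex carrier `ℚ̄^{Stab P} ⊔ ℚ⟮i⟯`, Lim's Lemma 3.2 descent with the normal core; no Lim 3.5,
no ascent) needs only `μ₂ = 0` along the cyclotomic `ℤ₂`-extensions of that carrier — §2 (the carrier is `ℚ(√−1)`). Replaces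
`conjA_two_of_not_irreducible hLim2 hFW` (p621123 road) with NO hypothesis. The printed odd-`p` analogue is Coates–Sujatha Cor. 3.6.
[cite: CoatesSujatha2005, Conj. A, Thm. 3.4 and Cor. 3.6] [cite: Lim2017FineSelmer, §3 Lemma 3.2 and Remark (a)]
[cite: Wuthrich2014, Lemma 14 (p. 396)] [cite: Greenberg2001IwasawaPastPresent, Prop. 2.1 p. 339] -/
theorem conjA_two_of_not_hasIrreducibleModPGaloisRep_two (W : WeierstrassCurve ℚ) [W.IsElliptic]
    (hred : ¬ W.HasIrreducibleModPGaloisRep 2) :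
    ∀ (κ : ZpExtension ℚ 2), κ.IsCyclotomic →
      ∃ (γ : absoluteGaloisGroup ℚ) (D : W.FineSelmerDualData κ γ),
        Module.Finite ℤ_[2] (RestrictScalars ℤ_[2] (IwasawaAlgebra 2) D.X) := by
  intro κ hκ
  obtain ⟨P, hP0, hfix⟩ := exists_twoTorsion_ne_zero_forall_smul_eq_of_not_irreducible W hred
  obtain ⟨i, hi⟩ := IsAlgClosed.exists_pow_nat_eq (-1 : AlgebraicClosure ℚ) two_pos
  exact PointFieldMu.exists_fineSelmerDualData_moduleFinite_of_classicalMu_pointField_adjoin W hP0 hi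
    (fun κF _ => classicalMuVanishes_pointField_adjoin_I_of_forall_smul_eq W hfix hi κF) κ hκ

/-- **(A)₂ for every elliptic `W/ℚ` with `2 ∣ #W(ℚ)_tors` — KERNEL** (a rational point of order `2` makes `W[2]` reducible,
`not_hasIrreducibleModPGaloisRep_of_dvd_torsionOrder`; then §3). Replaces `conjA_two_of_dvd_torsionOrder hLim2 hFW`.
[cite: Mazur1977, Ch. III §5, p. 157] [cite: CoatesSujatha2005, Conj. A and Cor. 3.6] -/
theorem conjA_two_of_dvd_torsionOrder_two (W : WeierstrassCurve ℚ) [W.IsElliptic] [W.IsGloballyMinimal]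
    (htors : 2 ∣ W.torsionOrder) :
    ∀ (κ : ZpExtension ℚ 2), κ.IsCyclotomic →
      ∃ (γ : absoluteGaloisGroup ℚ) (D : W.FineSelmerDualData κ γ),
        Module.Finite ℤ_[2] (RestrictScalars ℤ_[2] (IwasawaAlgebra 2) D.X) :=
  haveI : Fact (Nat.Prime 2) := ⟨Nat.prime_two⟩
  conjA_two_of_not_hasIrreducibleModPGaloisRep_two W (not_hasIrreducibleModPGaloisRep_of_dvd_torsionOrder W 2 htors)

end Summit.BirchSwinnertonDyer.BirchSwinnertonDyer.Theorems.AddKatoTwo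

end
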